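import Summits.AtomisticToContinuum.BoseEinsteinCondensation.Theorems.BECInfDivCoherenceLevyNegativeMomentRieszTwoDim

/-!
# Crux `LevyNegativeMoment` (stmt-AtomisticToContinuum-9115), line `registered`, stub `stub_rieszSum` —
# part F: the coordinate split `q = (a, p)` of `(ℤ/m)³` and the trivial bound

Helper file (lead prover of the line) for the L-free grid Riesz sum bound (stub `stub_rieszSum`).

* `sum_pi_three_split`: `Σ_{q : Fin 3 → Fin m} F q = Σ_{p : Fin 2 → Fin m} Σ_{a : Fin m} F(insertNth k₀ a p)`
  for any distinguished coordinate `k₀` (`Fin.insertNthEquiv`), with the phase and the squared folded norm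
  splitting accordingly (`phase_split`, `barSq_split`);
* the trivial bound `|Σ_q cos(2π q·j/m)/‖q̄‖| ≤ Σ_q 1/‖q̄‖ ≤ 18 m²` (`abs_cosSum_le_sum_inv`, `sum_inv_bar_le`),
  via the max-norm domination of part E (the term `q = 0` is `1/√0 = 0` by the junk value of division).
-/

namespace Summit.AtomisticToContinuum.BoseEinsteinCondensation.Cruxes.LevyNegativeMoment.Birth.Riesz

open scoped BigOperators
open Finset

/-! ## The coordinate split -/

/-- `Σ_{q : Fin 3 → Fin m} F q = Σ_p Σ_a F (insertNth k₀ a p)`. [folklore] -/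
theorem sum_pi_three_split {M : Type*} [AddCommMonoid M] (m : ℕ) (k₀ : Fin 3)
    (F : (Fin 3 → Fin m) → M) :
    ∑ q : Fin 3 → Fin m, F q =
      ∑ p : Fin 2 → Fin m, ∑ a : Fin m, F (Fin.insertNth (α := fun _ => Fin m) k₀ a p) := by
  rw [← Fintype.sum_equiv (Fin.insertNthEquiv (fun _ : Fin 3 => Fin m) k₀)
      (fun x => F (Fin.insertNth (α := fun _ => Fin m) k₀ x.1 x.2)) F
      (fun x => by simp [Fin.insertNthEquiv]),
    Fintype.sum_prod_type, Finset.sum_comm]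

/-- The phase splits: `Σ_k q_k j_k = a j_{k₀} + Σ_i p_i j_{k₀.succAbove i}` for `q = insertNth k₀ a p`.
[folklore] -/
theorem phase_split (m : ℕ) (j : Fin 3 → Fin m) (k₀ : Fin 3) (a : Fin m) (p : Fin 2 → Fin m) :
    (∑ k, ((Fin.insertNth (α := fun _ => Fin m) k₀ a p k : ℕ) : ℝ) * ((j k : ℕ) : ℝ))
      = (a : ℕ) * ((j k₀ : ℕ) : ℝ) +
        ∑ i : Fin 2, ((p i : ℕ) : ℝ) * ((j (k₀.succAbove i) : ℕ) : ℝ) := by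
  rw [Fin.sum_univ_succAbove _ k₀, Fin.insertNth_apply_same]
  congr 1
  refine Fintype.sum_congr _ _ fun i => ?_
  rw [Fin.insertNth_apply_succAbove]

/-- The squared folded norm splits: `Σ_k q̄_k² = ā² + Σ_i p̄_i²` for `q = insertNth k₀ a p`. [folklore] -/
theorem barSq_split (m : ℕ) (k₀ : Fin 3) (a : Fin m) (p : Fin 2 → Fin m) :
    (∑ k, ((min (Fin.insertNth (α := fun _ => Fin m) k₀ a p k : ℕ)
        (m - (Fin.insertNth (α := fun _ => Fin m) k₀ a p k : ℕ)) : ℕ) : ℝ) ^ 2)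
      = ((min (a : ℕ) (m - a) : ℕ) : ℝ) ^ 2 +
        ∑ i : Fin 2, ((min (p i : ℕ) (m - p i) : ℕ) : ℝ) ^ 2 := by
  rw [Fin.sum_univ_succAbove _ k₀, Fin.insertNth_apply_same]
  congr 1
  refine Fintype.sum_congr _ _ fun i => ?_
  rw [Fin.insertNth_apply_succAbove]

/-- `Σ_{i : Fin 2} p̄_i² ≥ (max(p̄₀, p̄₁))²`. [folklore] -/
theorem maxBar_sq_le (m : ℕ) (p : Fin 2 → Fin m) :
    ((max (min (p 0 : ℕ) (m - p 0)) (min (p 1 : ℕ) (m - p 1)) : ℕ) : ℝ) ^ 2 ≤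
      ∑ i : Fin 2, ((min (p i : ℕ) (m - p i) : ℕ) : ℝ) ^ 2 := by
  rw [Fin.sum_univ_two]
  rcases le_total (min (p 0 : ℕ) (m - p 0)) (min (p 1 : ℕ) (m - p 1)) with h | h
  · rw [max_eq_right h]; nlinarith [sq_nonneg (((min (p 0 : ℕ) (m - p 0)) : ℕ) : ℝ)]
  · rw [max_eq_left h]; nlinarith [sq_nonneg (((min (p 1 : ℕ) (m - p 1)) : ℕ) : ℝ)]

/-! ## The trivial bound -/

/-- `|Σ_q cos(θ_q)/w_q| ≤ Σ_q 1/w_q` for nonnegative weights (`1/0 = 0` included). [folklore] -/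
theorem abs_cosSum_le_sum_inv (m : ℕ) (θ : (Fin 3 → Fin m) → ℝ) (w : (Fin 3 → Fin m) → ℝ)
    (hw : ∀ q, 0 ≤ w q) :
    |∑ q : Fin 3 → Fin m, Real.cos (θ q) / w q| ≤ ∑ q : Fin 3 → Fin m, (w q)⁻¹ := by
  refine (abs_sum_le_sum_abs _ _).trans (sum_le_sum fun q _ => ?_)
  rw [abs_div, abs_of_nonneg (hw q), div_eq_mul_inv]
  rcases eq_or_lt_of_le (hw q) with h | h
  · rw [← h]; simp
  · calc |Real.cos (θ q)| * (w q)⁻¹ ≤ 1 * (w q)⁻¹ := by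
          gcongr; exact Real.abs_cos_le_one _
      _ = (w q)⁻¹ := one_mul _

/-- The transverse majorant of `1/‖q̄‖`: `1/√(ā² + Σ p̄²) ≤ 1/max(r_p, 1)`, `r_p = max(p̄₀, p̄₁)`. [folklore] -/
theorem inv_sqrt_le_inv_maxBar (m : ℕ) (a : Fin m) (p : Fin 2 → Fin m) :
    (Real.sqrt (((min (a : ℕ) (m - a) : ℕ) : ℝ) ^ 2 +
        ∑ i : Fin 2, ((min (p i : ℕ) (m - p i) : ℕ) : ℝ) ^ 2))⁻¹ ≤
      ((max (max (min (p 0 : ℕ) (m - p 0)) (min (p 1 : ℕ) (m - p 1))) 1 : ℕ) : ℝ)⁻¹ := by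
  set r : ℕ := max (min (p 0 : ℕ) (m - p 0)) (min (p 1 : ℕ) (m - p 1)) with hr
  have hsq := maxBar_sq_le m p
  rw [← hr] at hsq
  rcases Nat.eq_zero_or_pos r with h0 | hpos
  · -- r = 0: the bound is 1
    rw [h0]
    simp only [zero_le, max_eq_right, Nat.cast_one, inv_one]
    set x : ℝ := Real.sqrt (((min (a : ℕ) (m - a) : ℕ) : ℝ) ^ 2 +
        ∑ i : Fin 2, ((min (p i : ℕ) (m - p i) : ℕ) : ℝ) ^ 2) with hx
    rcases eq_or_lt_of_le (Real.sqrt_nonneg (((min (a : ℕ) (m - a) : ℕ) : ℝ) ^ 2 +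
        ∑ i : Fin 2, ((min (p i : ℕ) (m - p i) : ℕ) : ℝ) ^ 2)) with h | h
    · rw [← hx] at h; rw [← h]; simp
    · rw [← hx] at h
      apply inv_le_one_of_one_le₀
      -- x ≥ 1: since r = 0 means both p̄ = 0, x = ā, and x > 0 forces ā ≥ 1
      have hp0 : ∑ i : Fin 2, ((min (p i : ℕ) (m - p i) : ℕ) : ℝ) ^ 2 = 0 := by
        rw [Fin.sum_univ_two]
        have h0' : min (p 0 : ℕ) (m - p 0) = 0 ∧ min (p 1 : ℕ) (m - p 1) = 0 := by
          constructor <;> omega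
        rw [h0'.1, h0'.2]; simp
      have hxa : x = ((min (a : ℕ) (m - a) : ℕ) : ℝ) := by
        rw [hx, hp0, add_zero, Real.sqrt_sq (by positivity)]
      rw [hxa] at h ⊢
      have : (0 : ℕ) < min (a : ℕ) (m - a) := by exact_mod_cast h
      exact_mod_cast this
  · rw [max_eq_left hpos]
    have hr1 : (0 : ℝ) < r := by exact_mod_cast hpos
    apply inv_anti₀ hr1
    calc (r : ℝ) = Real.sqrt ((r : ℝ) ^ 2) := (Real.sqrt_sq hr1.le).symm
      _ ≤ _ := Real.sqrt_le_sqrt (by nlinarith [sq_nonneg (((min (a : ℕ) (m - a) : ℕ) : ℝ))])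

/-- **Trivial bound**: `Σ_{q : (ℤ/m)³} 1/‖q̄‖ ≤ 18 m²` (the `q = 0` term is `1/√0 = 0`). [folklore] -/
theorem sum_inv_bar_le (m : ℕ) :
    ∑ q : Fin 3 → Fin m, (Real.sqrt (∑ k, ((min (q k : ℕ) (m - (q k : ℕ)) : ℕ) : ℝ) ^ 2))⁻¹ ≤
      18 * (m : ℝ) ^ 2 := by
  rw [sum_pi_three_split m 0, Finset.sum_comm]
  have inner : ∀ a : Fin m, ∑ p : Fin 2 → Fin m,
      (Real.sqrt (∑ k, ((min (Fin.insertNth (α := fun _ => Fin m) 0 a p k : ℕ)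
        (m - (Fin.insertNth (α := fun _ => Fin m) 0 a p k : ℕ)) : ℕ) : ℝ) ^ 2))⁻¹ ≤ 12 * (m / 2 + 1 : ℕ) := by
    intro a
    calc _ ≤ ∑ p : Fin 2 → Fin m,
          ((max (max (min (p 0 : ℕ) (m - p 0)) (min (p 1 : ℕ) (m - p 1))) 1 : ℕ) : ℝ)⁻¹ := by
            refine sum_le_sum fun p _ => ?_
            rw [barSq_split]
            exact inv_sqrt_le_inv_maxBar m a p
      _ ≤ 4 * ∑ u ∈ range (m / 2 + 1), (2 * u + 1) * ((max u 1 : ℕ) : ℝ)⁻¹ :=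
            sum_pi_two_le (Φ := fun u => ((max u 1 : ℕ) : ℝ)⁻¹) (fun u => by positivity)
      _ ≤ 4 * ∑ u ∈ range (m / 2 + 1), (3 : ℝ) := by
            gcongr with u hu
            rcases Nat.eq_zero_or_pos u with h | h
            · subst h; norm_num
            · rw [max_eq_left h]
              have hu' : (0 : ℝ) < u := by exact_mod_cast h
              rw [← div_eq_mul_inv, div_le_iff₀ hu']
              have : (1 : ℝ) ≤ u := by exact_mod_cast h
              linarith
      _ = 12 * (m / 2 + 1 : ℕ) := by
            rw [sum_const, card_range, nsmul_eq_mul]; push_cast; ring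
  calc _ ≤ ∑ _a : Fin m, (12 : ℝ) * (m / 2 + 1 : ℕ) := sum_le_sum fun a _ => inner a
    _ = m * (12 * (m / 2 + 1 : ℕ)) := by rw [sum_const, card_univ, Fintype.card_fin, nsmul_eq_mul]
    _ ≤ 18 * (m : ℝ) ^ 2 := by
        have h2 : ((m / 2 : ℕ) : ℝ) ≤ (m : ℝ) / 2 := by
          have := Nat.div_mul_le_self m 2
          have : ((m / 2 : ℕ) : ℝ) * 2 ≤ m := by exact_mod_cast this
          linarith
        rcases Nat.eq_zero_or_pos m with hm | hm
        · subst hm; simp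
        · have hm1 : (1 : ℝ) ≤ m := by exact_mod_cast hm
          push_cast
          nlinarith

end Summit.AtomisticToContinuum.BoseEinsteinCondensation.Cruxes.LevyNegativeMoment.Birth.Riesz
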